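import Literature.Dynamics.Ergodic.ToralEndomorphismsKernelsDense
import Literature.AlgebraicGeometry.HodgeTheory.AbelianVarietyExactEndomorphisms
import Literature.AlgebraicGeometry.HodgeTheory.AbelianVarietyIsogenyDegreeSign
import Literature.AlgebraicGeometry.HodgeTheory.AbelianVarietyIsogenyDegreeHomology
import HarnessLib

/-!
# Kernels of the iterates of an isogeny: `⋃ₙ Ker fⁿ(ℂ)` is dense in `A(ℂ)` ⟺ `f(ℂ)` is exact (Cuntz–Vershik,
# Rohlin); the torsion packets `Ker fⁿ(ℂ)` and `A[m](ℂ)` equidistribute toward the Haar measure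

Lane `lit-hodgefound`, row g22-#1 FILE 2 (prover seat `lit-hodgefound-p31`): the lane file of
`Literature/Dynamics/Ergodic/ToralEndomorphismsKernelsDense.lean` (Cuntz–Vershik §2 after Rohlin: an algebraic
endomorphism `α` of a compact abelian group is exact iff `⋃ₙ Ker αⁿ` is dense; on `𝕋^d` the kernels and fibres of
`T_Aⁿ` and the torsion levels `𝕋^d[m]` equidistribute toward the Haar measure — Weyl's criterion for finite
subsets), read on the tree's complex tori `X = E/Φ(ℤ^ι)` (`ComplexTorus Φ`, endomorphisms `ρ(M) = mapMatrix Φ Φ M`)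
and on the complex points `A(ℂ)` of a complex abelian variety through the uniformisation
(`complexAbelianVariety_torusUniformised_holds`, `exists_mapMatrix_comp_eq_of_hom`: `f(ℂ) ∘ φ = φ ∘ ρ(ρ_r(f))`) and
the Haar probability measure `μ` of `A(ℂ)` (`eq_map_volume_of_map_mul_right_eq`).  Sequel of
`AbelianVarietyExactEndomorphisms.lean` (Krzyżewski's criterion for exactness of `f(ℂ)`) and
`AbelianVarietyTorsionPointsDense.lean` (all torsion points are dense).

## The printed statements

J. Cuntz, A. Vershik, Comm. Math. Phys. 321 (2013), §2 (held arXiv:1202.5960 chunk p0005 L15–L31): for a surjective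
endomorphism `α` with finite kernel of a compact abelian group `H`, «`⋂_{n∈ℕ} φⁿG = {0}` which, by duality, means
that `⋃_{n∈ℕ} Ker αⁿ` is dense in `H` […] For an algebraic endomorphism of the compact group `H` this condition
[exactness] means exactly that the subgroup `⋃_{n∈ℕ} Ker αⁿ` is dense in `H`.»  Here `H = A(ℂ)` — a compact
connected commutative complex Lie group `≅ ℂ^g/Λ` (Mumford §1 (1)–(2); as a topological group `(ℝ/ℤ)^{2g}`) — and
`α = f(ℂ)` for an isogeny `f : A → A`, whose kernels `Ker fⁿ(ℂ) = Ker (fⁿ)(ℂ)` are finite groups of torsion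
points with `|Ker f(ℂ)|ⁿ = (deg f)ⁿ` elements (Lange Prop. 1.1.13 (c): `deg f = |det ρ_r(f)|`, the tree's
`AbelianVariety.natCard_kerPoints_eq_natAbs_det_of_end`), and `|A[m](ℂ)| = m^{2g}` (Prop. 1.1.14, the tree's
`IsogenyDegree.natCard_torsionPoints_complex`).  K. K. S. Andersen, K. Thomsen, Doc. Math. 17 (2012) Thm. 4.1
(Krzyżewski): exact ⟺ no unimodular polynomial divides the characteristic polynomial.

## What is formalised (theorems only; no definition, no named fact)

§1 complex tori, `det M ≠ 0`: `ComplexTorus.isExactEndomorphism_mapMatrix_iff_dense_iUnion_ker_iterate`,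
`ComplexTorus.dense_iUnion_ker_mapMatrix_iterate_iff_forall_not_dvd_charpoly`,
`ComplexTorus.isExactEndomorphism_mapMatrix_iff_tendsto_finsetAvg_ker_iterate`,
`ComplexTorus.IsExactEndomorphism.tendsto_finsetAvg_preimage_mapMatrix_iterate`, the expanding and the automorphism
cases, and `ComplexTorus.tendsto_finsetAvg_nsmul` (the `m`-division points of any `xₘ ∈ X` equidistribute, `m → ∞`).
§2 a complex abelian variety `A`, `f : A ⟶ A`, `F = f(ℂ)`:
**`AbelianVariety.dense_iUnion_ker_iterate_iff_forall_not_dvd_charpoly`** (for an isogeny: `⋃ₙ Ker Fⁿ` dense in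
`A(ℂ)` ⟺ no unimodular polynomial divides `χ(F^* | H¹(A(ℂ); ℚ))`), the expanding case
`AbelianVariety.dense_iUnion_ker_iterate_of_forall_one_lt_norm`, the automorphism case
`AbelianVariety.not_dense_iUnion_ker_iterate_of_isIso`; and, for the Haar probability measure `μ` of `A(ℂ)`:
**`AbelianVariety.isExactEndomorphism_mapContinuous_iff_dense_iUnion_ker_iterate`** (the printed statement),
**`AbelianVariety.IsExactEndomorphism.tendsto_finsetAvg_preimage_iterate`** (for exact `F` the fibres `F⁻ⁿ{Pₙ}` —
`(deg f)ⁿ` points — equidistribute toward `μ` for every sequence `Pₙ`),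
`AbelianVariety.isExactEndomorphism_mapContinuous_iff_tendsto_finsetAvg_ker_iterate`,
**`AbelianVariety.tendsto_finsetAvg_torsionPoints`** (`A[m](ℂ)` equidistributes toward `μ` as `m → ∞`) and
`AbelianVariety.tendsto_finsetAvg_pow_eq` (so do the `m`-division points of any `Pₘ`).

## References

* [CuntzVershik2012] J. Cuntz, A. Vershik, Comm. Math. Phys. 321 (2013) 157–179, §2 (held text arXiv:1202.5960
  chunk p0005).
* [Rohlin1964] V. A. Rohlin, *Exact endomorphisms of a Lebesgue space*, AMS Transl. (2) 39 (1964) 1–36 (cite-only).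
* [AndersenThomsen2012] K. K. S. Andersen, K. Thomsen, Doc. Math. 17 (2012) 545–572, §4 Thm. 4.1 (held text
  arXiv:1204.0224 chunk p0010). [Krzyzewski1993] K. Krzyżewski, Monatsh. Math. 116 (1993) 39–47 (cite-only).
* [KuipersNiederreiter1974] L. Kuipers, H. Niederreiter, *Uniform Distribution of Sequences* (1974), Ch. 1 §6
  Theorems 6.2–6.3.
* [Lange2023AbelianVarietiesComplex] H. Lange, *Abelian Varieties over the Complex Numbers* (2023), §1.1.2
  Prop. 1.1.6, Prop. 1.1.13, Prop. 1.1.14, §1.1.3 Lemma 1.1.17 (PDF pp. 19–23).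
* [MumfordAV1970] D. Mumford, *Abelian Varieties* (1970), §1 (1)–(2).
* [Walters1982] P. Walters, *An Introduction to Ergodic Theory*, GTM 79 (1982), §0.6 Thm. 0.13, §4.9 Def. 4.14,
  §5.3 Thm. 5.11 (held text chunks p0022, p0126, p0141).
-/

noncomputable section

-- `ComplexTorus Φ` (for `Φ : ℝ^ι ≃ E`) is the type `ι → ℝ/ℤ = UnitAddTorus ι`; instance paths up to unfolding
set_option backward.isDefEq.respectTransparency false
-- nested instance problems on the carriers (cf. `AbelianVarietyErgodicEndomorphisms.lean`)
set_option maxSynthPendingDepth 3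

open scoped Manifold
open CategoryTheory Module Function MeasureTheory MeasureTheory.Measure Set Filter Topology Polynomial
open Literature.AlgebraicTopology.SingularHomology Literature.NumberTheory.Transcendental
  Literature.NumberTheory.LFunctions Literature.Dynamics.Ergodic
open Literature.AlgebraicGeometry.Motives (ComplexPoints IsSmoothProjective AbelianVariety SchemeOver AlgPoints
  specOver)
open Literature.AlgebraicGeometry.Motives.AbelianVariety (Hom.kerPoints)

/-! ### §1 Complex tori -/

namespace Literature.Geometry.Kaehler.ComplexTorus

variable {ι : Type*} [Fintype ι] [DecidableEq ι] {E : Type*} [NormedAddCommGroup E] [NormedSpace ℂ E]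
  (Φ : (ι → ℝ) ≃L[ℝ] E)

/-- **Cuntz–Vershik §2 on a complex torus: `ρ(M)` is an exact endomorphism of `X = E/Φ(ℤ^ι)` (Haar probability
measure) iff `⋃ₙ ker ρ(M)ⁿ` is dense in `X`** (`det M ≠ 0`).
[cite: CuntzVershik2012, §2 (held text arXiv:1202.5960 chunk p0005)] [cite: Rohlin1964, §3]
[cite: Walters1982, §4.9 Definition 4.14 (held text chunk p0126)] -/
theorem isExactEndomorphism_mapMatrix_iff_dense_iUnion_ker_iterate {M : Matrix ι ι ℤ} (hM : M.det ≠ 0) :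
    IsExactEndomorphism (mapMatrix Φ Φ M) volume ↔
      Dense (⋃ n : ℕ, ((mapMatrix Φ Φ M)^[n]) ⁻¹' ({0} : Set (ComplexTorus Φ))) :=
  ToralEndomorphism.isExactEndomorphism_iff_dense_iUnion_ker_iterate M (T := mapMatrix Φ Φ M) (mapMatrix_apply M) hM

/-- **`⋃ₙ ker ρ(M)ⁿ` is dense in `X` iff no unimodular polynomial divides `χ_M`** (`det M ≠ 0`; Krzyżewski /
Andersen–Thomsen Thm. 4.1). [cite: CuntzVershik2012, §2 (held text arXiv:1202.5960 chunk p0005)]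
[cite: AndersenThomsen2012, §4 Theorem 4.1 (held text arXiv:1204.0224 chunk p0010)] [cite: Krzyzewski1993, Theorem (abstract)] -/
theorem dense_iUnion_ker_mapMatrix_iterate_iff_forall_not_dvd_charpoly {M : Matrix ι ι ℤ} (hM : M.det ≠ 0) :
    Dense (⋃ n : ℕ, ((mapMatrix Φ Φ M)^[n]) ⁻¹' ({0} : Set (ComplexTorus Φ))) ↔
      ∀ g : ℤ[X], g.Monic → 0 < g.natDegree → IsUnit (g.coeff 0) → ¬ g ∣ M.charpoly :=
  ToralEndomorphism.dense_iUnion_ker_iterate_iff_forall_not_dvd_charpoly M (T := mapMatrix Φ Φ M)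
    (mapMatrix_apply M) hM

/-- **`ρ(M)` is exact iff its kernels equidistribute**: for `det M ≠ 0`, `ρ(M)` is an exact endomorphism of `X` iff
`|det M|⁻ⁿ Σ_{y ∈ ker ρ(M)ⁿ} g(y) → ∫ g` for every continuous `g : X → ℂ`.
[cite: CuntzVershik2012, §2 (held text arXiv:1202.5960 chunk p0005)] [cite: KuipersNiederreiter1974, Ch. 1 §6 Theorems 6.2–6.3] -/
theorem isExactEndomorphism_mapMatrix_iff_tendsto_finsetAvg_ker_iterate {M : Matrix ι ι ℤ} (hM : M.det ≠ 0) :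
    IsExactEndomorphism (mapMatrix Φ Φ M) volume ↔ ∀ g : C(ComplexTorus Φ, ℂ),
      Tendsto (fun n ↦ (∑ᶠ y ∈ ((mapMatrix Φ Φ M)^[n]) ⁻¹' {0}, g y) / ((M.det.natAbs : ℂ) ^ n)) atTop
        (𝓝 (∫ z : ComplexTorus Φ, g z)) :=
  ToralEndomorphism.isExactEndomorphism_iff_tendsto_finsetAvg_ker_iterate M (T := mapMatrix Φ Φ M)
    (mapMatrix_apply M) hM

/-- **The fibres of an exact `ρ(M)` equidistribute**: if `ρ(M)` is exact (`det M ≠ 0`) then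
`|det M|⁻ⁿ Σ_{ρ(M)ⁿ y = xₙ} g(y) → ∫ g` for every continuous `g : X → ℂ` and every sequence `xₙ ∈ X`.
[cite: CuntzVershik2012, §2 (held text arXiv:1202.5960 chunk p0005)] [cite: KuipersNiederreiter1974, Ch. 1 §6 Theorems 6.2–6.3] -/
theorem IsExactEndomorphism.tendsto_finsetAvg_preimage_mapMatrix_iterate {M : Matrix ι ι ℤ} (hM : M.det ≠ 0)
    (hex : IsExactEndomorphism (mapMatrix Φ Φ M) volume) (g : C(ComplexTorus Φ, ℂ)) (x : ℕ → ComplexTorus Φ) :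
    Tendsto (fun n ↦ (∑ᶠ y ∈ ((mapMatrix Φ Φ M)^[n]) ⁻¹' {x n}, g y) / ((M.det.natAbs : ℂ) ^ n)) atTop
      (𝓝 (∫ z : ComplexTorus Φ, g z)) :=
  ToralEndomorphism.IsExactEndomorphism.tendsto_finsetAvg_preimage_iterate M (T := mapMatrix Φ Φ M)
    (mapMatrix_apply M) hM hex g x

/-- **Expanding endomorphisms of a complex torus have dense iterated kernels**: if every complex eigenvalue of `M`
has modulus `> 1` then `⋃ₙ ker ρ(M)ⁿ` is dense. [cite: CuntzVershik2012, §2 (held text arXiv:1202.5960 chunk p0005)]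
[cite: AndersenThomsen2012, §4 Theorem 4.1 / Theorem 4.3 (1) (held text arXiv:1204.0224 chunks p0010, p0014)] -/
theorem dense_iUnion_ker_mapMatrix_iterate_of_forall_one_lt_norm {M : Matrix ι ι ℤ}
    (hexp : ∀ α ∈ (M.map (Int.castRingHom ℂ)).charpoly.roots, 1 < ‖α‖) :
    Dense (⋃ n : ℕ, ((mapMatrix Φ Φ M)^[n]) ⁻¹' ({0} : Set (ComplexTorus Φ))) :=
  ToralEndomorphism.dense_iUnion_ker_iterate_of_forall_one_lt_norm M (T := mapMatrix Φ Φ M) (mapMatrix_apply M) hexp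

/-- **Automorphisms of a complex torus have no dense iterated kernels** (`det M = ±1`, `ι ≠ ∅`).
[cite: CuntzVershik2012, §2 (held text arXiv:1202.5960 chunk p0005)] [cite: Walters1982, §4.9 Definition 4.14 and the remark after it (held text chunk p0126)] -/
theorem not_dense_iUnion_ker_mapMatrix_iterate_of_isUnit_det [Nonempty ι] {M : Matrix ι ι ℤ} (hM : IsUnit M.det) :
    ¬ Dense (⋃ n : ℕ, ((mapMatrix Φ Φ M)^[n]) ⁻¹' ({0} : Set (ComplexTorus Φ))) :=
  ToralEndomorphism.not_dense_iUnion_ker_iterate_of_isUnit_det M (T := mapMatrix Φ Φ M) (mapMatrix_apply M) hM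

omit [DecidableEq ι] in
/-- **The `m`-division points of any `xₘ ∈ X` equidistribute toward the Haar measure of a complex torus** as
`m → ∞` (`m^{-|ι|} Σ_{m y = xₘ} g(y) → ∫ g`; with `xₘ = 0`: the torsion levels `X[m]`, `m^{2 dim X}` points each).
[cite: Walters1982, §5.3 Theorem 5.11 and its proof (held text chunk p0141)] [cite: KuipersNiederreiter1974, Ch. 1 §6 Theorems 6.2–6.3]
[cite: Lange2023AbelianVarietiesComplex, §1.1.2 Prop. 1.1.14 (PDF p. 22)] -/
theorem tendsto_finsetAvg_nsmul (g : C(ComplexTorus Φ, ℂ)) (x : ℕ → ComplexTorus Φ) :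
    Tendsto (fun m : ℕ ↦ (∑ᶠ y ∈ (fun z : ComplexTorus Φ ↦ m • z) ⁻¹' {x m}, g y) / ((m : ℂ) ^ Fintype.card ι))
      atTop (𝓝 (∫ z : ComplexTorus Φ, g z)) := by
  classical
  exact Literature.Dynamics.Ergodic.tendsto_finsetAvg_nsmul (d := ι) g x

end Literature.Geometry.Kaehler.ComplexTorus

/-! ### §2 Complex abelian varieties -/

namespace Literature.AlgebraicGeometry.HodgeTheory

open Literature.Geometry.Kaehler

/-! #### Transport along a uniformisation `φ : X ≃ A(ℂ)` with `f(ℂ) ∘ φ = φ ∘ ρ(M)` -/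

section Transport

variable (A : AbelianVariety ℂ) (f : A ⟶ A) {ι : Type} [Fintype ι] [DecidableEq ι]
  {E : Type} [NormedAddCommGroup E] [NormedSpace ℂ E] [FiniteDimensional ℂ E] {Φ : (ι → ℝ) ≃L[ℝ] E}
  {φ : ComplexTorus Φ → ComplexPoints A.X} (hφ : IsAnalytification E A.X A.dim φ)
  (hadd : ∀ x y, φ (x + y) = φ x * φ y) {M : Matrix ι ι ℤ}
  (hM : ∀ t, φ (ComplexTorus.mapMatrix Φ Φ M t) = AlgPoints.mapContinuous (L := ℂ) f.hom.hom.hom (φ t))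

omit [Fintype ι] [DecidableEq ι] [FiniteDimensional ℂ E] in
include hadd in
/-- A uniformisation that is a group homomorphism sends `0` to `1`. [cite: MumfordAV1970, §1 (1)–(2)] -/
private theorem map_zero_eq_one''' : φ 0 = 1 := by
  have h := hadd 0 0
  rw [add_zero] at h
  exact mul_eq_left.1 h.symm

omit [Fintype ι] [DecidableEq ι] [FiniteDimensional ℂ E] in
include hadd in
/-- `φ (m • t) = φ(t)^m`. [cite: MumfordAV1970, §1 (1)–(2)] -/
private theorem map_nsmul_eq_pow''' (m : ℕ) (t : ComplexTorus Φ) : φ (m • t) = φ t ^ m := by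
  induction m with
  | zero => rw [zero_nsmul, pow_zero, map_zero_eq_one''' A hadd]
  | succ m ih => rw [succ_nsmul, hadd, ih, pow_succ]

omit [DecidableEq ι] [FiniteDimensional ℂ E] in
include hM in
/-- `φ ∘ ρ(M)ⁿ = f(ℂ)ⁿ ∘ φ`. [cite: Lange2023AbelianVarietiesComplex, §1.1.2 Prop. 1.1.6 (PDF p. 19)] -/
private theorem map_mapMatrix_iterate (n : ℕ) (t : ComplexTorus Φ) :
    φ ((ComplexTorus.mapMatrix Φ Φ M)^[n] t) = (AlgPoints.mapContinuous (L := ℂ) f.hom.hom.hom)^[n] (φ t) :=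
  (Function.Semiconj.iterate_right hM n) t

omit [DecidableEq ι] in
include hφ hM in
/-- **`φ` maps the fibre `ρ(M)⁻ⁿ{x}` onto the fibre `f(ℂ)⁻ⁿ{φ x}`.**
[cite: Lange2023AbelianVarietiesComplex, §1.1.2 Prop. 1.1.6 (PDF p. 19)] -/
private theorem image_preimage_mapMatrix_iterate (n : ℕ) (x : ComplexTorus Φ) :
    φ '' (((ComplexTorus.mapMatrix Φ Φ M)^[n]) ⁻¹' {x}) =
      ((AlgPoints.mapContinuous (L := ℂ) f.hom.hom.hom)^[n]) ⁻¹' {φ x} := by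
  ext P
  constructor
  · rintro ⟨t, ht, rfl⟩
    have ht' : (ComplexTorus.mapMatrix Φ Φ M)^[n] t = x := ht
    show (AlgPoints.mapContinuous (L := ℂ) f.hom.hom.hom)^[n] (φ t) ∈ ({φ x} : Set (ComplexPoints A.X))
    rw [← map_mapMatrix_iterate A f hM n t, ht']
    exact Set.mem_singleton _
  · intro hP
    obtain ⟨t, rfl⟩ := hφ.isHomeomorph.surjective P
    refine ⟨t, ?_, rfl⟩
    have h : φ ((ComplexTorus.mapMatrix Φ Φ M)^[n] t) = φ x := by
      rw [map_mapMatrix_iterate A f hM n t]; exact hP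
    exact hφ.isHomeomorph.injective h

omit [DecidableEq ι] in
include hφ hadd hM in
/-- **`φ` maps `⋃ₙ ker ρ(M)ⁿ` onto `⋃ₙ Ker f(ℂ)ⁿ`.** [cite: Lange2023AbelianVarietiesComplex, §1.1.2 Prop. 1.1.6 (PDF p. 19)] -/
private theorem image_iUnion_ker_mapMatrix_iterate :
    φ '' (⋃ n : ℕ, ((ComplexTorus.mapMatrix Φ Φ M)^[n]) ⁻¹' ({0} : Set (ComplexTorus Φ))) =
      ⋃ n : ℕ, ((AlgPoints.mapContinuous (L := ℂ) f.hom.hom.hom)^[n]) ⁻¹' ({1} : Set (ComplexPoints A.X)) := by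
  rw [Set.image_iUnion]
  refine Set.iUnion_congr fun n ↦ ?_
  rw [image_preimage_mapMatrix_iterate A f hφ hM n 0, map_zero_eq_one''' A hadd]

omit [DecidableEq ι] in
include hφ hadd hM in
/-- **`⋃ₙ Ker f(ℂ)ⁿ` is dense in `A(ℂ)` iff `⋃ₙ ker ρ(M)ⁿ` is dense in `X`** (`φ` is a homeomorphism).
[cite: Lange2023AbelianVarietiesComplex, §1.1.2 Prop. 1.1.6 (PDF p. 19)] [cite: MumfordAV1970, §1 (1)–(2)] -/
private theorem dense_iUnion_ker_iterate_iff_dense_mapMatrix :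
    Dense (⋃ n : ℕ, ((AlgPoints.mapContinuous (L := ℂ) f.hom.hom.hom)^[n]) ⁻¹' ({1} : Set (ComplexPoints A.X))) ↔
      Dense (⋃ n : ℕ, ((ComplexTorus.mapMatrix Φ Φ M)^[n]) ⁻¹' ({0} : Set (ComplexTorus Φ))) := by
  rw [← image_iUnion_ker_mapMatrix_iterate A f hφ hadd hM]
  constructor
  · intro h
    have h2 := h.preimage hφ.isHomeomorph.isOpenMap
    rwa [Set.preimage_image_eq _ hφ.isHomeomorph.injective] at h2
  · exact fun h ↦ hφ.isHomeomorph.surjective.denseRange.dense_image hφ.isHomeomorph.continuous h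

omit [DecidableEq ι] in
include hφ hM in
/-- Sums over the fibre `f(ℂ)⁻ⁿ{φ x}` are sums over `ρ(M)⁻ⁿ{x}`. [cite: Lange2023AbelianVarietiesComplex, §1.1.2 Prop. 1.1.6 (PDF p. 19)] -/
private theorem finsum_preimage_iterate_eq (g : ComplexPoints A.X → ℂ) (n : ℕ) (x : ComplexTorus Φ) :
    ∑ᶠ P ∈ ((AlgPoints.mapContinuous (L := ℂ) f.hom.hom.hom)^[n]) ⁻¹' {φ x}, g P =
      ∑ᶠ t ∈ ((ComplexTorus.mapMatrix Φ Φ M)^[n]) ⁻¹' {x}, g (φ t) := by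
  rw [← image_preimage_mapMatrix_iterate A f hφ hM n x, finsum_mem_image hφ.isHomeomorph.injective.injOn]

omit [DecidableEq ι] in
include hφ hadd in
/-- **`φ` maps the `m`-division points of `x` onto the `m`-division points of `φ x`** (`φ (m t) = φ(t)^m`).
[cite: MumfordAV1970, §1 (1)–(2)] -/
private theorem image_preimage_nsmul (m : ℕ) (x : ComplexTorus Φ) :
    φ '' ((fun t : ComplexTorus Φ ↦ m • t) ⁻¹' {x}) = (fun P : A.Points ℂ ↦ P ^ m) ⁻¹' {φ x} := by
  ext P
  constructor
  · rintro ⟨t, ht, rfl⟩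
    have ht' : m • t = x := ht
    show φ t ^ m ∈ ({φ x} : Set (ComplexPoints A.X))
    rw [← map_nsmul_eq_pow''' A hadd m t, ht']
    exact Set.mem_singleton _
  · intro hP
    obtain ⟨t, rfl⟩ := hφ.isHomeomorph.surjective P
    refine ⟨t, ?_, rfl⟩
    have h : φ (m • t) = φ x := by rw [map_nsmul_eq_pow''' A hadd m t]; exact hP
    exact hφ.isHomeomorph.injective h

omit [DecidableEq ι] in
include hφ hadd in
/-- Sums over the `m`-division points of `φ x` are sums over the `m`-division points of `x`. [cite: MumfordAV1970, §1 (1)–(2)] -/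
private theorem finsum_preimage_pow_eq (g : ComplexPoints A.X → ℂ) (m : ℕ) (x : ComplexTorus Φ) :
    ∑ᶠ P ∈ (fun P : A.Points ℂ ↦ P ^ m) ⁻¹' {φ x}, g P = ∑ᶠ t ∈ (fun t : ComplexTorus Φ ↦ m • t) ⁻¹' {x}, g (φ t) := by
  rw [← image_preimage_nsmul A hφ hadd m x, finsum_mem_image hφ.isHomeomorph.injective.injOn]

omit [DecidableEq ι] in
include hφ in
/-- `φ (φ⁻¹ P) = P` for the homeomorphism underlying the uniformisation. [cite: MumfordAV1970, §1 (1)–(2)] -/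
private theorem apply_homeomorph_symm''' (P : ComplexPoints A.X) : φ (hφ.homeomorph.symm P) = P := by
  have h := hφ.homeomorph.apply_symm_apply P
  rwa [IsAnalytification.coe_homeomorph] at h

omit [DecidableEq ι] in
include hφ hadd in
/-- **Integrals against the Haar probability measure of `A(ℂ)` are integrals over the torus**: `μ = φ_* vol`
(`eq_map_volume_of_map_mul_right_eq`). [cite: Walters1982, §0.6 Theorem 0.13 (held text chunk p0022)] -/
private theorem integral_eq_integral_comp [MeasurableSpace (ComplexPoints A.X)] [BorelSpace (ComplexPoints A.X)]
    (μ : Measure (ComplexPoints A.X)) [IsProbabilityMeasure μ]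
    (hμ : ∀ Q : A.Points ℂ, Measure.map (fun P : A.Points ℂ ↦ P * Q) μ = μ) (g : C(ComplexPoints A.X, ℂ)) :
    ∫ P, g P ∂μ = ∫ t, g (φ t) ∂(volume : Measure (ComplexTorus Φ)) := by
  rw [eq_map_volume_of_map_mul_right_eq A hφ hadd μ hμ,
    integral_map hφ.isHomeomorph.continuous.measurable.aemeasurable g.continuous.aestronglyMeasurable]

include hφ hM in
/-- **`|Ker f(ℂ)| = |det M|`** for the covering matrix `M = ρ_r(f)` (Prop. 1.1.13 (c):
`AbelianVariety.natCard_kerPoints_eq_natAbs_det_of_end` and `det_singularHomology_map_one`).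
[cite: Lange2023AbelianVarietiesComplex, §1.1.2 Prop. 1.1.13 (c) (PDF p. 22)] -/
private theorem natCard_kerPoints_eq_natAbs_det''' : Nat.card (Hom.kerPoints (specOver ℂ ℂ) f) = M.det.natAbs := by
  rw [AbelianVariety.natCard_kerPoints_eq_natAbs_det_of_end f,
    det_singularHomology_map_one Φ A ⟨φ, hφ.isHomeomorph.continuous⟩ hφ
      (AlgPoints.mapContinuous (L := ℂ) f.hom.hom.hom) M hM]

end Transport

/-! #### The kernel of `f(ℂ)` and the torsion subgroups as fibres -/

section Fibres

variable (A : AbelianVariety ℂ) (f : A ⟶ A)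

/-- `Ker f(ℂ) = f(ℂ)⁻¹{1}` (the tree's `Hom.kerPoints` on `ℂ`-points is the fibre of `f(ℂ) : A(ℂ) → A(ℂ)` over
`1`). [cite: Lange2023AbelianVarietiesComplex, §1.1.2 definition of the degree (PDF p. 21)] -/
theorem AbelianVariety.preimage_mapContinuous_one_eq_kerPoints :
    (AlgPoints.mapContinuous (L := ℂ) f.hom.hom.hom) ⁻¹' ({1} : Set (ComplexPoints A.X)) =
      (Hom.kerPoints (specOver ℂ ℂ) f : Set (A.Points ℂ)) := by
  ext P
  rw [Set.mem_preimage, Set.mem_singleton_iff, SetLike.mem_coe, AbelianVariety.Hom.mem_kerPoints_iff,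
    AlgPoints.mapContinuous_apply, AlgPoints.map_apply]

/-- `A[m](ℂ) = (P ↦ P^m)⁻¹{1}`. [cite: MumfordAV1970, §6 (p. 64)] -/
theorem AbelianVariety.preimage_pow_one_eq_torsionPoints (m : ℕ) :
    (fun P : A.Points ℂ ↦ P ^ m) ⁻¹' ({1} : Set (A.Points ℂ)) = (A.torsionPoints ℂ (m : ℤ) : Set (A.Points ℂ)) := by
  ext P
  rw [Set.mem_preimage, Set.mem_singleton_iff, SetLike.mem_coe, Motives.AbelianVariety.mem_torsionPoints_iff,
    zpow_natCast]

end Fibres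

/-! #### Density of `⋃ₙ Ker f(ℂ)ⁿ` (no measure) -/

section Dense

variable (A : AbelianVariety ℂ) (f : A ⟶ A)

/-- **`⋃ₙ Ker fⁿ(ℂ)` is dense in `A(ℂ)` iff no unimodular polynomial divides `χ(f(ℂ)^* | H¹(A(ℂ); ℚ))`**, for an
isogeny `f` of a complex abelian variety `A` (unimodular: monic, integral, positive degree, constant term `±1`):
uniformise `A(ℂ) ≅ X = E/Φ(ℤ^ι)` with `f(ℂ) ≅ ρ(M)`, `M = ρ_r(f)` non-singular, transport density along the
homeomorphism, apply §1 and read `χ_M = χ(f(ℂ)^* | H¹)` (row A1-34's `charpoly_singularCohomology_rat_map_one`).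
[cite: CuntzVershik2012, §2 (held text arXiv:1202.5960 chunk p0005)]
[cite: AndersenThomsen2012, §4 Theorem 4.1 (held text arXiv:1204.0224 chunk p0010)] [cite: Krzyzewski1993, Theorem (abstract)]
[cite: Lange2023AbelianVarietiesComplex, §1.1.2 Prop. 1.1.6 and §1.1.3 Lemma 1.1.17 (a) (PDF pp. 19, 23)] -/
theorem AbelianVariety.dense_iUnion_ker_iterate_iff_forall_not_dvd_charpoly (hf : Motives.AbelianVariety.IsIsogeny f) :
    Dense (⋃ n : ℕ, ((AlgPoints.mapContinuous (L := ℂ) f.hom.hom.hom)^[n]) ⁻¹' ({1} : Set (ComplexPoints A.X))) ↔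
      ∀ g : ℤ[X], g.Monic → 0 < g.natDegree → IsUnit (g.coeff 0) →
        ¬ g.map (Int.castRingHom ℚ) ∣
          (singularCohomology.map ℚ ℚ (AlgPoints.mapContinuous (L := ℂ) f.hom.hom.hom) 1).hom.charpoly := by
  obtain ⟨ι, _, _, Φ, φ, hφ, hadd⟩ := complexAbelianVariety_torusUniformised_holds A
  obtain ⟨M, hM⟩ := exists_mapMatrix_comp_eq_of_hom Φ Φ ⟨φ, hφ.isHomeomorph.continuous⟩ hφ hadd
    ⟨φ, hφ.isHomeomorph.continuous⟩ hφ hadd f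
  have hM' : ∀ t, φ (ComplexTorus.mapMatrix Φ Φ M t) = AlgPoints.mapContinuous (L := ℂ) f.hom.hom.hom (φ t) :=
    fun t ↦ hM t
  have hdet : M.det ≠ 0 := by
    rw [← det_singularHomology_map_one Φ A ⟨φ, hφ.isHomeomorph.continuous⟩ hφ
      (AlgPoints.mapContinuous (L := ℂ) f.hom.hom.hom) M hM]
    exact (AbelianVariety.isIsogeny_iff_det_singularHomology_map_one_ne_zero f).1 hf
  have hg : ∀ t, (⟨φ, hφ.isHomeomorph.continuous⟩ : C(ComplexTorus Φ, ComplexPoints A.X))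
      (ComplexTorus.mapMatrix Φ Φ M t + 0) = (AlgPoints.mapContinuous (L := ℂ) f.hom.hom.hom) (φ t) := fun t ↦ by
    rw [add_zero]
    exact hM t
  rw [dense_iUnion_ker_iterate_iff_dense_mapMatrix A f hφ hadd hM',
    ComplexTorus.dense_iUnion_ker_mapMatrix_iterate_iff_forall_not_dvd_charpoly Φ hdet,
    charpoly_singularCohomology_rat_map_one Φ A ⟨φ, hφ.isHomeomorph.continuous⟩ hφ
      (AlgPoints.mapContinuous (L := ℂ) f.hom.hom.hom) M 0 hg]
  refine forall_congr' fun g ↦ forall_congr' fun hmonic ↦ forall_congr' fun _ ↦ forall_congr' fun _ ↦ ?_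
  rw [Polynomial.map_dvd_map (Int.castRingHom ℚ) (Int.castRingHom ℚ).injective_int hmonic]

/-- **Expanding isogenies have dense iterated kernels**: if every eigenvalue of `f(ℂ)^*` on `H¹(A(ℂ); ℚ)` has
modulus `> 1` then `⋃ₙ Ker fⁿ(ℂ)` is dense in `A(ℂ)` (e.g. `f = [k]_A`, `|k| ≥ 2`).
[cite: CuntzVershik2012, §2 (held text arXiv:1202.5960 chunk p0005)]
[cite: AndersenThomsen2012, §4 Theorem 4.1 / Theorem 4.3 (1) (held text arXiv:1204.0224 chunks p0010, p0014)] -/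
theorem AbelianVariety.dense_iUnion_ker_iterate_of_forall_one_lt_norm
    (hexp : ∀ α ∈ FrobeniusCharpoly.eigenvalues ℂ
        (singularCohomology.map ℚ ℚ (AlgPoints.mapContinuous (L := ℂ) f.hom.hom.hom) 1).hom, 1 < ‖α‖) :
    Dense (⋃ n : ℕ, ((AlgPoints.mapContinuous (L := ℂ) f.hom.hom.hom)^[n]) ⁻¹' ({1} : Set (ComplexPoints A.X))) := by
  obtain ⟨ι, _, _, Φ, φ, hφ, hadd⟩ := complexAbelianVariety_torusUniformised_holds A
  obtain ⟨M, hM⟩ := exists_mapMatrix_comp_eq_of_hom Φ Φ ⟨φ, hφ.isHomeomorph.continuous⟩ hφ hadd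
    ⟨φ, hφ.isHomeomorph.continuous⟩ hφ hadd f
  have hM' : ∀ t, φ (ComplexTorus.mapMatrix Φ Φ M t) = AlgPoints.mapContinuous (L := ℂ) f.hom.hom.hom (φ t) :=
    fun t ↦ hM t
  rw [eigenvalues_singularCohomology_map_one_eq_roots_charpoly A f hφ hM'] at hexp
  rw [dense_iUnion_ker_iterate_iff_dense_mapMatrix A f hφ hadd hM']
  exact ComplexTorus.dense_iUnion_ker_mapMatrix_iterate_of_forall_one_lt_norm Φ hexp

/-- **An automorphism of a positive-dimensional complex abelian variety has no dense iterated kernels**: every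
`Ker fⁿ(ℂ)` is `{1}`, and `{1}` is not dense in the infinite Hausdorff space `A(ℂ)` («exact endomorphisms are as
far from being invertible as possible»). [cite: CuntzVershik2012, §2 (held text arXiv:1202.5960 chunk p0005)]
[cite: Walters1982, §4.9 Definition 4.14 and the remark after it (held text chunk p0126)] -/
theorem AbelianVariety.not_dense_iUnion_ker_iterate_of_isIso [IsIso f] (hA : 0 < A.dim) :
    ¬ Dense (⋃ n : ℕ, ((AlgPoints.mapContinuous (L := ℂ) f.hom.hom.hom)^[n]) ⁻¹' ({1} : Set (ComplexPoints A.X))) := by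
  -- `f(ℂ)` is injective with `f(ℂ) 1 = 1`, so every iterated kernel is `{1}`
  have hinj : Injective (AlgPoints.mapContinuous (L := ℂ) f.hom.hom.hom) := by
    have hid1 : ∀ P, AlgPoints.mapContinuous (L := ℂ) (inv f).hom.hom.hom
        (AlgPoints.mapContinuous (L := ℂ) f.hom.hom.hom P) = P := fun P ↦ by
      have hid : f.hom.hom.hom ≫ (inv f).hom.hom.hom = 𝟙 A.X := by
        change (f ≫ inv f).hom.hom.hom = (𝟙 A : A ⟶ A).hom.hom.hom
        rw [IsIso.hom_inv_id]
      rw [AlgPoints.mapContinuous_apply, AlgPoints.mapContinuous_apply, ← AlgPoints.map_comp_apply, hid,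
        AlgPoints.map_id_apply]
    exact LeftInverse.injective hid1
  have hone : AlgPoints.mapContinuous (L := ℂ) f.hom.hom.hom 1 = 1 := by
    rw [AlgPoints.mapContinuous_apply, AlgPoints.map_apply]
    exact (AbelianVariety.Hom.mem_kerPoints_iff f (1 : A.Points ℂ)).1
      (AbelianVariety.Hom.one_mem_kerPoints (T := specOver ℂ ℂ) f)
  have hker : ∀ n : ℕ, ((AlgPoints.mapContinuous (L := ℂ) f.hom.hom.hom)^[n]) ⁻¹' ({1} : Set (ComplexPoints A.X)) = {1} := by
    intro n
    ext P
    rw [Set.mem_preimage, Set.mem_singleton_iff, Set.mem_singleton_iff]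
    constructor
    · intro h
      have h1 : (AlgPoints.mapContinuous (L := ℂ) f.hom.hom.hom)^[n] 1 = 1 :=
        Function.iterate_fixed hone n
      exact (hinj.iterate n) (h.trans h1.symm)
    · rintro rfl
      exact Function.iterate_fixed hone n
  simp_rw [hker, Set.iUnion_const]
  -- `{1}` is closed and `A(ℂ)` is infinite
  intro hd
  haveI := infinite_points_of_dim_pos A hA
  have huniv : ({1} : Set (ComplexPoints A.X)) = Set.univ := by
    rw [← hd.closure_eq, closure_singleton]
  have hfin : (Set.univ : Set (ComplexPoints A.X)).Finite := by
    rw [← huniv]; exact Set.finite_singleton 1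
  exact Set.infinite_univ hfin

end Dense

/-! #### Exactness, equidistribution of the fibres `f(ℂ)⁻ⁿ{Pₙ}` and of the torsion packets -/

section Haar

variable (A : AbelianVariety ℂ) (f : A ⟶ A) [MeasurableSpace (ComplexPoints A.X)] [BorelSpace (ComplexPoints A.X)]
  (μ : Measure (ComplexPoints A.X)) [IsProbabilityMeasure μ]
  (hμ : ∀ Q : A.Points ℂ, Measure.map (fun P : A.Points ℂ ↦ P * Q) μ = μ)

include hμ in
/-- **Cuntz–Vershik §2 on a complex abelian variety: for an isogeny `f : A → A` and the Haar probability measure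
`μ` of `A(ℂ)`, `f(ℂ)` is an exact endomorphism of `(A(ℂ), μ)` iff `⋃ₙ Ker fⁿ(ℂ)` is dense in `A(ℂ)`** («For an
algebraic endomorphism of the compact group `H` this condition means exactly that the subgroup `⋃_{n∈ℕ} Ker αⁿ`
is dense in `H`»; uniformise and use §1 — exactness and density both transport along `φ : X ≃ A(ℂ)`).
[cite: CuntzVershik2012, §2 (held text arXiv:1202.5960 chunk p0005)] [cite: Rohlin1964, §3]
[cite: Walters1982, §4.9 Definition 4.14 and §0.6 Theorem 0.13 (held text chunks p0126, p0022)]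
[cite: Lange2023AbelianVarietiesComplex, §1.1.2 Prop. 1.1.6 (PDF p. 19)] -/
theorem AbelianVariety.isExactEndomorphism_mapContinuous_iff_dense_iUnion_ker_iterate
    (hf : Motives.AbelianVariety.IsIsogeny f) :
    IsExactEndomorphism (AlgPoints.mapContinuous (L := ℂ) f.hom.hom.hom) μ ↔
      Dense (⋃ n : ℕ, ((AlgPoints.mapContinuous (L := ℂ) f.hom.hom.hom)^[n]) ⁻¹' ({1} : Set (ComplexPoints A.X))) := by
  obtain ⟨ι, _, _, Φ, φ, hφ, hadd⟩ := complexAbelianVariety_torusUniformised_holds A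
  obtain ⟨M, hM⟩ := exists_mapMatrix_comp_eq_of_hom Φ Φ ⟨φ, hφ.isHomeomorph.continuous⟩ hφ hadd
    ⟨φ, hφ.isHomeomorph.continuous⟩ hφ hadd f
  have hM' : ∀ t, φ (ComplexTorus.mapMatrix Φ Φ M t) = AlgPoints.mapContinuous (L := ℂ) f.hom.hom.hom (φ t) :=
    fun t ↦ hM t
  have hdet : M.det ≠ 0 := by
    rw [← det_singularHomology_map_one Φ A ⟨φ, hφ.isHomeomorph.continuous⟩ hφ
      (AlgPoints.mapContinuous (L := ℂ) f.hom.hom.hom) M hM]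
    exact (AbelianVariety.isIsogeny_iff_det_singularHomology_map_one_ne_zero f).1 hf
  rw [isExactEndomorphism_mapContinuous_iff_isExactEndomorphism_mapMatrix A f μ hμ hφ hadd hM',
    ComplexTorus.isExactEndomorphism_mapMatrix_iff_dense_iUnion_ker_iterate Φ hdet,
    dense_iUnion_ker_iterate_iff_dense_mapMatrix A f hφ hadd hM']

include hμ in
/-- **The fibres of an exact isogeny equidistribute toward the Haar measure.** If `f(ℂ)` is an exact endomorphism
of `(A(ℂ), μ)` (so `f` is an isogeny of degree `deg f = |Ker f(ℂ)| ≥ 2`), then for every continuous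
`g : A(ℂ) → ℂ` and EVERY sequence of points `Pₙ ∈ A(ℂ)`,
`(deg f)⁻ⁿ Σ_{f(ℂ)ⁿ Q = Pₙ} g(Q) → ∫ g dμ` — each fibre `f(ℂ)⁻ⁿ{Pₙ}`, a coset of the torsion packet
`Ker fⁿ(ℂ)`, has `(deg f)ⁿ` points.  (Kernels: `Pₙ = 1`; all `fⁿ`-division points of a point: `Pₙ = P`.)
[cite: CuntzVershik2012, §2 (held text arXiv:1202.5960 chunk p0005)] [cite: KuipersNiederreiter1974, Ch. 1 §6 Theorems 6.2–6.3]
[cite: Lange2023AbelianVarietiesComplex, §1.1.2 Prop. 1.1.6 and Prop. 1.1.13 (c) (PDF pp. 19, 22)]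
[cite: Walters1982, §0.6 Theorem 0.13 (held text chunk p0022)] -/
theorem AbelianVariety.IsExactEndomorphism.tendsto_finsetAvg_preimage_iterate
    (hex : IsExactEndomorphism (AlgPoints.mapContinuous (L := ℂ) f.hom.hom.hom) μ)
    (g : C(ComplexPoints A.X, ℂ)) (P : ℕ → ComplexPoints A.X) :
    Tendsto (fun n ↦ (∑ᶠ Q ∈ ((AlgPoints.mapContinuous (L := ℂ) f.hom.hom.hom)^[n]) ⁻¹' {P n}, g Q) /
        ((Nat.card (Hom.kerPoints (specOver ℂ ℂ) f) : ℂ) ^ n)) atTop (𝓝 (∫ Q, g Q ∂μ)) := by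
  obtain ⟨ι, _, _, Φ, φ, hφ, hadd⟩ := complexAbelianVariety_torusUniformised_holds A
  obtain ⟨M, hM⟩ := exists_mapMatrix_comp_eq_of_hom Φ Φ ⟨φ, hφ.isHomeomorph.continuous⟩ hφ hadd
    ⟨φ, hφ.isHomeomorph.continuous⟩ hφ hadd f
  have hM' : ∀ t, φ (ComplexTorus.mapMatrix Φ Φ M t) = AlgPoints.mapContinuous (L := ℂ) f.hom.hom.hom (φ t) :=
    fun t ↦ hM t
  have hf : Motives.AbelianVariety.IsIsogeny f :=
    (AbelianVariety.measurePreserving_mapContinuous_iff_isIsogeny A f μ hμ).1 hex.measurePreserving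
  have hdet : M.det ≠ 0 := by
    rw [← det_singularHomology_map_one Φ A ⟨φ, hφ.isHomeomorph.continuous⟩ hφ
      (AlgPoints.mapContinuous (L := ℂ) f.hom.hom.hom) M hM]
    exact (AbelianVariety.isIsogeny_iff_det_singularHomology_map_one_ne_zero f).1 hf
  have hexM : IsExactEndomorphism (ComplexTorus.mapMatrix Φ Φ M) (volume : Measure (ComplexTorus Φ)) :=
    (isExactEndomorphism_mapContinuous_iff_isExactEndomorphism_mapMatrix A f μ hμ hφ hadd hM').1 hex
  -- base points and test function pulled back to the torus
  set x : ℕ → ComplexTorus Φ := fun n ↦ hφ.homeomorph.symm (P n) with hx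
  have hPx : ∀ n, φ (x n) = P n := fun n ↦ apply_homeomorph_symm''' A hφ (P n)
  have key := ComplexTorus.IsExactEndomorphism.tendsto_finsetAvg_preimage_mapMatrix_iterate Φ hdet hexM
    (g.comp ⟨φ, hφ.isHomeomorph.continuous⟩) x
  simp only [ContinuousMap.comp_apply, ContinuousMap.coe_mk] at key
  rw [← integral_eq_integral_comp A hφ hadd μ hμ g] at key
  refine key.congr' (Eventually.of_forall fun n ↦ ?_)
  beta_reduce
  rw [← hPx n, finsum_preimage_iterate_eq A f hφ hM' g n (x n), natCard_kerPoints_eq_natAbs_det''' A f hφ hM']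

include hμ in
/-- **The torsion packets `Ker fⁿ(ℂ)` of an exact isogeny equidistribute toward the Haar measure**
(`AbelianVariety.IsExactEndomorphism.tendsto_finsetAvg_preimage_iterate` with `Pₙ = 1`).
[cite: CuntzVershik2012, §2 (held text arXiv:1202.5960 chunk p0005)] [cite: KuipersNiederreiter1974, Ch. 1 §6 Theorems 6.2–6.3] -/
theorem AbelianVariety.IsExactEndomorphism.tendsto_finsetAvg_ker_iterate
    (hex : IsExactEndomorphism (AlgPoints.mapContinuous (L := ℂ) f.hom.hom.hom) μ) (g : C(ComplexPoints A.X, ℂ)) :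
    Tendsto (fun n ↦ (∑ᶠ Q ∈ ((AlgPoints.mapContinuous (L := ℂ) f.hom.hom.hom)^[n]) ⁻¹' {1}, g Q) /
        ((Nat.card (Hom.kerPoints (specOver ℂ ℂ) f) : ℂ) ^ n)) atTop (𝓝 (∫ Q, g Q ∂μ)) :=
  AbelianVariety.IsExactEndomorphism.tendsto_finsetAvg_preimage_iterate A f μ hμ hex g fun _ ↦ 1

include hμ in
/-- **An isogeny is exact iff its torsion packets `Ker fⁿ(ℂ)` equidistribute toward the Haar measure**: for an
isogeny `f` and the Haar probability measure `μ` of `A(ℂ)`, `f(ℂ)` is an exact endomorphism iff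
`(deg f)⁻ⁿ Σ_{Q ∈ Ker fⁿ(ℂ)} g(Q) → ∫ g dμ` for every continuous `g : A(ℂ) → ℂ`.
[cite: CuntzVershik2012, §2 (held text arXiv:1202.5960 chunk p0005)] [cite: KuipersNiederreiter1974, Ch. 1 §6 Theorems 6.2–6.3]
[cite: Lange2023AbelianVarietiesComplex, §1.1.2 Prop. 1.1.6 and Prop. 1.1.13 (c) (PDF pp. 19, 22)] -/
theorem AbelianVariety.isExactEndomorphism_mapContinuous_iff_tendsto_finsetAvg_ker_iterate
    (hf : Motives.AbelianVariety.IsIsogeny f) :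
    IsExactEndomorphism (AlgPoints.mapContinuous (L := ℂ) f.hom.hom.hom) μ ↔ ∀ g : C(ComplexPoints A.X, ℂ),
      Tendsto (fun n ↦ (∑ᶠ Q ∈ ((AlgPoints.mapContinuous (L := ℂ) f.hom.hom.hom)^[n]) ⁻¹' {1}, g Q) /
        ((Nat.card (Hom.kerPoints (specOver ℂ ℂ) f) : ℂ) ^ n)) atTop (𝓝 (∫ Q, g Q ∂μ)) := by
  refine ⟨fun hex g ↦ AbelianVariety.IsExactEndomorphism.tendsto_finsetAvg_ker_iterate A f μ hμ hex g, fun h ↦ ?_⟩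
  obtain ⟨ι, _, _, Φ, φ, hφ, hadd⟩ := complexAbelianVariety_torusUniformised_holds A
  obtain ⟨M, hM⟩ := exists_mapMatrix_comp_eq_of_hom Φ Φ ⟨φ, hφ.isHomeomorph.continuous⟩ hφ hadd
    ⟨φ, hφ.isHomeomorph.continuous⟩ hφ hadd f
  have hM' : ∀ t, φ (ComplexTorus.mapMatrix Φ Φ M t) = AlgPoints.mapContinuous (L := ℂ) f.hom.hom.hom (φ t) :=
    fun t ↦ hM t
  have hdet : M.det ≠ 0 := by
    rw [← det_singularHomology_map_one Φ A ⟨φ, hφ.isHomeomorph.continuous⟩ hφ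
      (AlgPoints.mapContinuous (L := ℂ) f.hom.hom.hom) M hM]
    exact (AbelianVariety.isIsogeny_iff_det_singularHomology_map_one_ne_zero f).1 hf
  rw [isExactEndomorphism_mapContinuous_iff_isExactEndomorphism_mapMatrix A f μ hμ hφ hadd hM',
    ComplexTorus.isExactEndomorphism_mapMatrix_iff_tendsto_finsetAvg_ker_iterate Φ hdet]
  intro g'
  -- `g' = g ∘ φ` for the continuous `g = g' ∘ φ⁻¹` on `A(ℂ)`
  set g : C(ComplexPoints A.X, ℂ) := g'.comp (hφ.homeomorph.symm : C(ComplexPoints A.X, ComplexTorus Φ)) with hg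
  have hgφ : ∀ t, g (φ t) = g' t := fun t ↦ by
    rw [hg, ContinuousMap.comp_apply, ContinuousMap.coe_coe]
    congr 1
    have h1 := hφ.homeomorph.symm_apply_apply t
    rwa [IsAnalytification.coe_homeomorph] at h1
  have key := h g
  rw [integral_eq_integral_comp A hφ hadd μ hμ g] at key
  simp_rw [hgφ] at key
  refine key.congr' (Eventually.of_forall fun n ↦ ?_)
  beta_reduce
  rw [← map_zero_eq_one''' A hadd, finsum_preimage_iterate_eq A f hφ hM' g n 0,
    natCard_kerPoints_eq_natAbs_det''' A f hφ hM']
  simp_rw [hgφ]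

include hμ in
/-- **The `m`-division points of any points `Pₘ ∈ A(ℂ)` equidistribute toward the Haar measure as `m → ∞`**:
`m^{-2g} Σ_{Q^m = Pₘ} g(Q) → ∫ g dμ` for every continuous `g : A(ℂ) → ℂ` (`g = dim A`; each fibre of `Q ↦ Q^m`
is a coset of `A[m](ℂ)`, `m^{2g}` points — Prop. 1.1.14; uniformise and apply the torus statement, `|ι| = 2g`).
[cite: Walters1982, §5.3 Theorem 5.11 and its proof (held text chunk p0141)] [cite: KuipersNiederreiter1974, Ch. 1 §6 Theorems 6.2–6.3]
[cite: Lange2023AbelianVarietiesComplex, §1.1.1 and §1.1.2 Prop. 1.1.14 (PDF pp. 16, 22)] [cite: MumfordAV1970, §1 (1)–(2)] -/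
theorem AbelianVariety.tendsto_finsetAvg_pow_eq (g : C(ComplexPoints A.X, ℂ)) (P : ℕ → ComplexPoints A.X) :
    Tendsto (fun m : ℕ ↦ (∑ᶠ Q ∈ (fun Q : A.Points ℂ ↦ Q ^ m) ⁻¹' {P m}, g Q) / ((m : ℂ) ^ (2 * A.dim)))
      atTop (𝓝 (∫ Q, g Q ∂μ)) := by
  obtain ⟨ι, _, _, Φ, φ, hφ, hadd⟩ := complexAbelianVariety_torusUniformised_holds A
  have hι : Fintype.card ι = 2 * A.dim := by
    rw [← hφ.finrank_eq, ← finrank_real_of_complex (Fin A.dim → ℂ), ← LinearEquiv.finrank_eq Φ.toLinearEquiv,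
      Module.finrank_fintype_fun_eq_card]
  set x : ℕ → ComplexTorus Φ := fun m ↦ hφ.homeomorph.symm (P m) with hx
  have hPx : ∀ m, φ (x m) = P m := fun m ↦ apply_homeomorph_symm''' A hφ (P m)
  have key := ComplexTorus.tendsto_finsetAvg_nsmul Φ (g.comp ⟨φ, hφ.isHomeomorph.continuous⟩) x
  simp only [ContinuousMap.comp_apply, ContinuousMap.coe_mk] at key
  rw [← integral_eq_integral_comp A hφ hadd μ hμ g, hι] at key
  refine key.congr' (Eventually.of_forall fun m ↦ ?_)
  beta_reduce
  rw [← hPx m, finsum_preimage_pow_eq A hφ hadd g m (x m)]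

include hμ in
/-- **The torsion subgroups `A[m](ℂ)` equidistribute toward the Haar measure as `m → ∞`**:
`m^{-2g} Σ_{Q ∈ A[m](ℂ)} g(Q) → ∫ g dμ` for every continuous `g : A(ℂ) → ℂ` (`|A[m](ℂ)| = m^{2g}`, the tree's
`IsogenyDegree.natCard_torsionPoints_complex`; the division-point statement at `Pₘ = 1`).  In particular every
non-empty open subset of `A(ℂ)` contains `m`-torsion points for all large `m` (cf. `AbelianVarietyTorsionPointsDense`).
[cite: Walters1982, §5.3 Theorem 5.11 and its proof (held text chunk p0141)] [cite: KuipersNiederreiter1974, Ch. 1 §6 Theorems 6.2–6.3]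
[cite: Lange2023AbelianVarietiesComplex, §1.1.2 Prop. 1.1.14 (PDF p. 22)] [cite: MumfordAV1970, §6 Application 3] -/
theorem AbelianVariety.tendsto_finsetAvg_torsionPoints (g : C(ComplexPoints A.X, ℂ)) :
    Tendsto (fun m : ℕ ↦ (∑ᶠ Q ∈ (A.torsionPoints ℂ (m : ℤ) : Set (A.Points ℂ)), g Q) / ((m : ℂ) ^ (2 * A.dim)))
      atTop (𝓝 (∫ Q, g Q ∂μ)) := by
  have h := AbelianVariety.tendsto_finsetAvg_pow_eq A μ hμ g fun _ ↦ 1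
  simp_rw [AbelianVariety.preimage_pow_one_eq_torsionPoints] at h
  exact h

end Haar

end Literature.AlgebraicGeometry.HodgeTheory
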